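import Summits.HodgeConjecture.HodgeConjecture.Theorems.MarkmanPartnerTransportPicardThreeK3SquaresQuadraticGenerator

/-!
# Route MarkmanPartnerTransport · crux `PicardThreeK3Squares` (stmt-HodgeConjecture-19652) —
# the RESIDUE of the crux modulo Kuga–Satake on the real-quadratic surfaces, in its sharpest form:
# a GENERATING cycle at `ρ(S) ∈ {4, 6, 10}`, ONE cycle with an irrational eigenvalue at `ρ(S) ∈ {7, 13}`

`…QuadraticGenerator` (this seat, gen 9) reduces the crux, modulo {Buskin, markings, Varesco 2023 Thm. 5.3} and the
Kuga–Satake statement on the surfaces with a real-quadratic generator, to the one-cycle DEGREE clause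
`OneCycleOfDegree` at `ρ(S) ∈ {4, 6, 7, 10, 13}`. At `ρ ∈ {4, 6, 10}` that clause asks for an eigenvalue of
ADMISSIBLE degree, which a cubic/quartic endomorphism field may not possess (e.g. `ρ = 4`, `[E:ℚ] = 3`, `l = 6`:
`3 · 2 · 3 + 4 = 22`), so there the right clause is gen 8's GENERATION clause; at `ρ ∈ {7, 13}` every admissible
degree is prime and ONE cycle with an irrational `(2,0)`-eigenvalue suffices
(`OneCycle.picardThreeK3Squares_of_oneCycle_of_generation`). This file records that split, off the
real-quadratic surfaces:

* `picardThreeK3Squares_of_kugaSatake_of_generation_and_oneCycle` — **`PicardThreeK3Squares` BY NAME from: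
  Buskin's Thm. 1.1, markings, Varesco's Thm. 5.3; the Kuga–Satake statement for the non-CM projective K3
  surfaces with `3 ≤ ρ(S) ≤ 16` carrying a real-quadratic generator; (GEN) on the non-CM, non-scalar surfaces
  WITHOUT real-quadratic generator at `ρ(S) ∈ {4, 6, 10}`, ONE endomorphism of `H²(S(ℂ); ℂ)` preserving
  rational classes and Hodge types, induced by an algebraic class on `S × S`, GENERATING `End_Hdg T(S)`;
  (ONE) on those at `ρ(S) ∈ {7, 13}`, ONE such endomorphism with a non-rational eigenvalue on a non-zero
  `(2,0)`-class.** Every other rank in `3..16` is scalar-or-CM (`ρ ∈ {3, 5, 9, 11, 15}`) or forces a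
  real-quadratic generator (`ρ ∈ {8, 12, 14, 16}`).

This is the honest open core of the crux after gen 9, as one kernel statement: algebraic real multiplication of
degree `≥ 3` — cubic at `ρ ∈ {4, 7, 10, 13}`, quartic at `ρ ∈ {6, 10}`, quintic at `ρ = 7`, sextic at `ρ = 4`
(van Geemen–Schütt's dihedral families give it for `ℚ(ζ₇)⁺` at `ρ = 4` and `ℚ(ζ₉)⁺` at `ρ = 10` only; existence of
the RM Hodge structures in every cell: Bayer-Fluckiger–van Geemen–Schütt). CONDITIONAL on the Kuga–Satake statement
(open in print); no definition, no sorry, no new named fact; nothing here proves HC or the crux.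
Prover seat hodge-nonav-19652-p1 (gen 9), `--supports stmt-HodgeConjecture-19652`.

References: van Geemen–Schütt, Forum Math. Sigma 13 (2025) e2, Thm. 1.1, §4.8, Rem. 4.9; B. van Geemen, Michigan
Math. J. 56 (2008) Lemma 3.2; M. Varesco, Math. Z. 305 (2023) Thm. 5.3; N. Buskin, J. reine angew. Math. 755 (2019)
Thm. 1.1; E. Bayer-Fluckiger, B. van Geemen, M. Schütt, arXiv:2401.04072, Thm. A.
-/

set_option linter.dupNamespace false

noncomputable section

namespace Summit.HodgeConjecture.HodgeConjecture.Theorems.MarkmanPartnerTransport.KugaSatakeSimilitude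

open Module CategoryTheory MonoidalCategory CartesianMonoidalCategory
open Literature.AlgebraicGeometry Literature.AlgebraicGeometry.Motives Literature.AlgebraicGeometry.HodgeTheory
open Literature.AlgebraicGeometry.Hyperkaehler Literature.AlgebraicGeometry.Surfaces
open Literature.AlgebraicTopology.SingularHomology
open Summit.HodgeConjecture.HodgeConjecture.Theorems
open Summit.HodgeConjecture.HodgeConjecture.Theorems.NikulinTwinTransport
open Summit.HodgeConjecture.HodgeConjecture.Theorems.MarkmanPartnerTransport
open Summit.HodgeConjecture.HodgeConjecture.Theses.MarkmanPartnerTransport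

variable {S : SchemeOver ℂ}

/-- `Corr[μ, hS ; γ, y] = fst_*(snd^* y ∪ γ)` on `H²(S(ℂ); ℂ)`. Local notation only. -/
local notation3 (prettyPrint := false) "Corr[" μ ", " hS " ; " γ ", " y "]" =>
  complexGysin μ (IsSmoothProjective.tensor_holds hS hS) hS
    (SemiCartesianMonoidalCategory.fst _ _) (rfl : 2 * 1 + 2 * 2 + 2 * 2 = 2 * 1 + 2 * (2 + 2))
    (cupProduct (rfl : 2 * 1 + 2 * 2 = 2 * 1 + 2 * 2)
      (complexBetti.map (SemiCartesianMonoidalCategory.snd _ _) (2 * 1) y) γ)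

/-- `Transc[S, y]`: `y` is cup-orthogonal to `N¹(S)`. Local notation only. -/
local notation3 (prettyPrint := false) "Transc[" S ", " y "]" =>
  (∀ d ∈ algebraicClasses S 1, cupProduct (rfl : 2 * 1 + 2 * 1 = 2 * 2) y d = 0)

/-- `Scalar[S]`: «`End_Hdg T(S) = ℚ`» (VERBATIM the clause of `HighPicard`). Local notation only. -/
local notation3 (prettyPrint := false) "Scalar[" S "]" =>
  (∀ (f : complexBetti S (2 * 1) →ₗ[ℂ] complexBetti S (2 * 1)),
    (∀ y, IsRationalClass y → IsRationalClass (f y)) →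
    (∀ (i j : ℕ) y, IsOfHodgeType 2 S (2 * 1) i j y → IsOfHodgeType 2 S (2 * 1) i j (f y)) →
    (∀ d ∈ algebraicClasses S 1, f d = 0) →
    (∀ y : complexBetti S (2 * 1), ∀ d ∈ algebraicClasses S 1,
      cupProduct (rfl : 2 * 1 + 2 * 1 = 2 * 2) (f y) d = 0) →
    ∃ a : ℚ, ∀ y : complexBetti S (2 * 1),
      (∀ d ∈ algebraicClasses S 1, cupProduct (rfl : 2 * 1 + 2 * 1 = 2 * 2) y d = 0) →
        f y = (a : ℂ) • y)

/-- `QuadGen[S]`: a real-quadratic generator (VERBATIM the clause of `…KugaSatakeQuadraticThird`). Local notation only. -/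
local notation3 (prettyPrint := false) "QuadGen[" S "]" =>
  (∃ (ψ : complexBetti S (2 * 1) →ₗ[ℂ] complexBetti S (2 * 1)) (d : ℚ), d ≠ 0 ∧
    (∀ y, IsRationalClass y → IsRationalClass (ψ y)) ∧
    (∀ (i j : ℕ) y, IsOfHodgeType 2 S (2 * 1) i j y → IsOfHodgeType 2 S (2 * 1) i j (ψ y)) ∧
    (∀ d' ∈ algebraicClasses S 1, ψ d' = 0) ∧
    (∀ y : complexBetti S (2 * 1), Transc[S, ψ y]) ∧
    (∀ y w : complexBetti S (2 * 1),
      cupProduct (rfl : 2 * 1 + 2 * 1 = 2 * 2) (ψ y) w = cupProduct (rfl : 2 * 1 + 2 * 1 = 2 * 2) y (ψ w)) ∧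
    (∀ y : complexBetti S (2 * 1), Transc[S, y] → ψ (ψ y) = (d : ℂ) • y) ∧
    TranscendentalEndomorphismsGeneratedBy S ψ)

/-- `GenCycle[S, hS]`: ONE endomorphism of `H²(S(ℂ); ℂ)` preserving rational classes and Hodge types, induced by
an algebraic class on `S × S`, GENERATING `End_Hdg T(S)` (VERBATIM the `hGen` clause of
`OneCycle.picardThreeK3Squares_of_oneCycle_of_generation`). Local notation only. -/
local notation3 (prettyPrint := false) "GenCycle[" S ", " hS "]" =>
  (∃ e : complexBetti S (2 * 1) →ₗ[ℂ] complexBetti S (2 * 1),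
    (∀ y, IsRationalClass y → IsRationalClass (e y)) ∧
    (∀ (i j : ℕ) y, IsOfHodgeType 2 S (2 * 1) i j y → IsOfHodgeType 2 S (2 * 1) i j (e y)) ∧
    (∃ γ ∈ algebraicClasses (S ⊗ S) 2, ∀ y : complexBetti S (2 * 1),
      e y = Corr[complexOrientationFamily, IsK3Surface.isSmoothProjective hS ; γ, y]) ∧
    TranscendentalEndomorphismsGeneratedBy S e)

/-- `IrrCycle[S, hS]`: ONE such cycle-induced endomorphism with a non-rational eigenvalue on a non-zero
`(2,0)`-class (VERBATIM the `hOne` clause of `OneCycle.picardThreeK3Squares_of_oneCycle_of_generation`).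
Local notation only. -/
local notation3 (prettyPrint := false) "IrrCycle[" S ", " hS "]" =>
  (∃ e : complexBetti S (2 * 1) →ₗ[ℂ] complexBetti S (2 * 1),
    (∀ y, IsRationalClass y → IsRationalClass (e y)) ∧
    (∀ (i j : ℕ) y, IsOfHodgeType 2 S (2 * 1) i j y → IsOfHodgeType 2 S (2 * 1) i j (e y)) ∧
    (∃ γ ∈ algebraicClasses (S ⊗ S) 2, ∀ y : complexBetti S (2 * 1),
      e y = Corr[complexOrientationFamily, IsK3Surface.isSmoothProjective hS ; γ, y]) ∧
    (∃ (σ₀ : complexBetti S (2 * 1)) (ev : ℂ), IsOfHodgeType 2 S (2 * 1) 2 0 σ₀ ∧ σ₀ ≠ 0 ∧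
      e σ₀ = ev • σ₀ ∧ ∀ a : ℚ, (a : ℂ) ≠ ev))

/-- **`PicardThreeK3Squares` BY NAME — the residue modulo Kuga–Satake on the real-quadratic surfaces, sharp
form.** Granted Buskin's Thm. 1.1, markings, Varesco's Thm. 5.3 and the Kuga–Satake statement for the non-CM
projective K3 surfaces with `3 ≤ ρ(S) ≤ 16` and a real-quadratic generator, the crux follows from (GEN) a
GENERATING cycle-induced endomorphism on the non-CM, non-scalar surfaces without real-quadratic generator at
`ρ(S) ∈ {4, 6, 10}`, and (ONE) one cycle-induced endomorphism with an irrational `(2,0)`-eigenvalue on those at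
`ρ(S) ∈ {7, 13}` (where `22 − ρ ∈ {15, 9}` forces prime degree, so one such endomorphism generates or `S` is CM:
`OneCycle.hodgeConjectureFor_square_of_oneCycle`). All other ranks: scalar-or-CM (`ρ ∈ {3,5,9,11,15}`,
`RealMultiplicationRanks.scalar_or_hasComplexMultiplication_of_forall_mul_add_ne`) or a real-quadratic generator
is forced (`ρ ∈ {8,12,14,16}`, `exists_quadraticGenerator_of_not_scalar`) and Kuga–Satake applies
(`hodgeConjectureFor_square_of_quadraticGenerator_of_kugaSatake`). Assembled on
`HighPicard.picardThreeK3Squares_of_realMultiplicationThird_le_sixteen` through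
`SectorIff.cycleInducedSector_of_hodgeConjectureFor_square`. CONDITIONAL; credits nothing to HC.
[cite: GeemenSchutt2023, Thm. 1.1, §4.8 and Rem. 4.9] [cite: Vangeemen2008, Lemma 3.2] [cite: Varesco2023, Thm. 5.3]
[cite: Buskin2019, Thm. 1.1] -/
theorem picardThreeK3Squares_of_kugaSatake_of_generation_and_oneCycle (hB : Buskin2019_hodgeIsometry_algebraic)
    (hmark : Huybrechts_K3_marking_exists)
    (hVar : Varesco2023_transcendentalHodgeSimilitude_algebraic_of_kugaSatake_K3)
    (hKS : ∀ (S : SchemeOver ℂ) (hS : IsK3Surface S), ¬ HasComplexMultiplication S →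
      3 ≤ Module.finrank ℂ ↥(algebraicClasses S 1) → Module.finrank ℂ ↥(algebraicClasses S 1) ≤ 16 →
      QuadGen[S] → IsKSCorrespondenceAlgebraicBetti hS.isSmoothProjective)
    (hGen : ∀ (S : SchemeOver ℂ) (hS : IsK3Surface S), ¬ HasComplexMultiplication S →
      (Module.finrank ℂ ↥(algebraicClasses S 1) = 4 ∨ Module.finrank ℂ ↥(algebraicClasses S 1) = 6 ∨
        Module.finrank ℂ ↥(algebraicClasses S 1) = 10) → ¬ Scalar[S] → ¬ QuadGen[S] → GenCycle[S, hS])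
    (hOne : ∀ (S : SchemeOver ℂ) (hS : IsK3Surface S), ¬ HasComplexMultiplication S →
      (Module.finrank ℂ ↥(algebraicClasses S 1) = 7 ∨ Module.finrank ℂ ↥(algebraicClasses S 1) = 13) →
      ¬ Scalar[S] → ¬ QuadGen[S] → IrrCycle[S, hS]) :
    PicardThreeK3Squares := by
  refine HighPicard.picardThreeK3Squares_of_realMultiplicationThird_le_sixteen hB hmark
    fun S hS hCM h3 h16 hQ ↦ SectorIff.cycleInducedSector_of_hodgeConjectureFor_square
      complexOrientationFamily hS.isSmoothProjective ?_
  by_cases hq : QuadGen[S]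
  · obtain ⟨η, p, x, hM⟩ := hmark S hS
    exact hodgeConjectureFor_square_of_quadraticGenerator_of_kugaSatake hVar hS hM (hKS S hS hCM h3 h16 hq) hq
  by_cases hgenρ : Module.finrank ℂ ↥(algebraicClasses S 1) = 4 ∨ Module.finrank ℂ ↥(algebraicClasses S 1) = 6 ∨
      Module.finrank ℂ ↥(algebraicClasses S 1) = 10
  · obtain ⟨e, hrat, htyp, hcyc, hgen⟩ := hGen S hS hCM hgenρ hQ hq
    exact OneCycle.hodgeConjectureFor_square_of_generatedBy_of_mapsTo complexOrientationFamily hS.isSmoothProjective e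
      (OneCycle.mapsTo_algebraicClasses_one hS.isSmoothProjective e hrat htyp) hcyc hgen
  by_cases honeρ : Module.finrank ℂ ↥(algebraicClasses S 1) = 7 ∨ Module.finrank ℂ ↥(algebraicClasses S 1) = 13
  · obtain ⟨e, hrat, htyp, hcyc, hev⟩ := hOne S hS hCM honeρ hQ hq
    have h2 : Module.finrank ℂ ↥(algebraicClasses S 1) ≠ 2 := by omega
    have h4 : Module.finrank ℂ ↥(algebraicClasses S 1) ≠ 4 := by omega
    have h6 : Module.finrank ℂ ↥(algebraicClasses S 1) ≠ 6 := by omega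
    have h10 : Module.finrank ℂ ↥(algebraicClasses S 1) ≠ 10 := by omega
    exact OneCycle.hodgeConjectureFor_square_of_oneCycle hmark hS
      (fun _ _ hd hm h ↦ OneCycle.prime_of_mul_add_eq h2 h4 h6 h10 hd hm h) hCM complexOrientationFamily e hrat
      htyp hcyc hev
  by_cases hquad : Module.finrank ℂ ↥(algebraicClasses S 1) = 8 ∨ Module.finrank ℂ ↥(algebraicClasses S 1) = 12 ∨
      Module.finrank ℂ ↥(algebraicClasses S 1) = 14 ∨ Module.finrank ℂ ↥(algebraicClasses S 1) = 16
  · exact absurd (exists_quadraticGenerator_of_not_scalar hmark hS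
      (fun _ _ hd hm h => eq_two_of_mul_add_eq_of_mem hd hm h hquad) hCM hQ) hq
  · have hodd : Module.finrank ℂ ↥(algebraicClasses S 1) = 3 ∨ Module.finrank ℂ ↥(algebraicClasses S 1) = 5 ∨
        Module.finrank ℂ ↥(algebraicClasses S 1) = 9 ∨ Module.finrank ℂ ↥(algebraicClasses S 1) = 11 ∨
        Module.finrank ℂ ↥(algebraicClasses S 1) = 15 := by omega
    rcases RealMultiplicationRanks.scalar_or_hasComplexMultiplication_of_forall_mul_add_ne hmark hS
        (fun e m he hm => mul_add_ne_of_mem he hm hodd) with hsc | hcm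
    · exact absurd hsc hQ
    · exact absurd hcm hCM

end Summit.HodgeConjecture.HodgeConjecture.Theorems.MarkmanPartnerTransport.KugaSatakeSimilitude

end
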